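import Summits.Schanuel.Schanuel.Theorems.RootDecomp1KNW96Core14
import Summits.Schanuel.Schanuel.Theorems.RootDecomp1KKummerClosure05
import Literature.NumberTheory.Transcendental.LogAlgebraicTranscendenceMeasure
import Literature.Uncategorized.W78LogMeasure

/-!
# RootDecomp1KNW96Core — lens 6, generation 24, node 3 (g24c) «W78 COR. 3.7 (CIJSOUW'S LOG-α MEASURE) + THE `W78LogMeasure` TWIN, HYPOTHESIS-FREE VIA THE NW96 KERNEL» (RULE G27 (iii); CLAIM L2258, ACK/CHECKLIST G27-α L2260, NODE L2265 / REQUEST L2266; critic VERDICT pending at staging — filed only on GO) — continuation (RootDecomp1KNW96Core16): §W1–§W3a: numerics, `wphi`, `kappaLog`, `cijsouw_real`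

(lens-6 g24c HOME kernel K = HOME/decomp-schanuel-lens-6/g24c/NW96W78.lean 0d67db34…, 579 l, imports tree `…RootDecomp1KNW96Core14` + `…RootDecomp1KKummerClosure05` + Literature `…LogAlgebraicTranscendenceMeasure` + `Literature.Uncategorized.W78LogMeasure`; P/C per NODE-g24c.md. Port by census-1 gen 19 as `RootDecomp1KNW96Core16` = §W1 elementary real inequalities (private) + §W2 the degree-monotone approximation function `wphi κ d L = κ·d(log L + d log d)/(1 + log d)` (Cijsouw's shape), `wphi_nonneg/mono`, `kappa_le_mul_wphi` + §W3 `kappaLog`, the pure-real lemma `cijsouw_real`; `RootDecomp1KNW96Core17` = §W3 `log_approx_cijsouw (hNW : NesterenkoWaldschmidt1996_thm_1)` (Thm-1 instance θ := λ, α := e^λ, β := ξ, D := [ℚ(e^λ, ξ):ℚ], log A := log M(A_α)+1, log B := h(ξ), E := e·D) + §W4 `waldschmidt1978_cor_3_7_explicit`, `waldschmidt1978_cor_3_7_of_NW1996`, the headlines `waldschmidt1978_cor_3_7_holds : Waldschmidt1978_cor_3_7` (via the tree's `nesterenkoWaldschmidt1996_thm_1_holds`, Core14) and `w78LogMeasure_iff_cor_3_7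 := Iff.rfl`, `w78LogMeasure_holds : Literature.Uncategorized.W78LogMeasure` — HYPOTHESIS-FREE.
PORT EDITS: the file-wide linter option dropped; four generic real/height lemmas private (`mul_one_add_log_le`, `self_le_log_add_mul_log`, `log_absorb`, `length_le_of_height_le`) with per-part private copies; one docstring added (`kappaLog_nonneg`); statements and proofs verbatim. `--supports stmt-Schanuel-33364`; no census credit carried; rung 0 — nothing here proves Schanuel. CONSEQUENCE OF RECORD on GO: the 19 `(hlm : W78LogMeasure)` binders in 9 files (+4 in the Literature file) are dischargeable BY NAME — census relabel ×0.)
-/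

namespace Summit.Schanuel.Schanuel.Theorems.RootDecomp1KNW96Core

open Polynomial Complex IntermediateField
open Literature.NumberTheory.Transcendental
open Summit.Schanuel.Schanuel.Theorems.RootDecomp1KHyper.HyperCell (pair_bounds)

section W78Log

/-!
# RootDecomp1KNW96Core — §W: Waldschmidt 1978 Cor. 3.7 (Cijsouw's transcendence measure for `log α`)
# HYPOTHESIS-FREE, from Nesterenko–Waldschmidt 1996 Theorem 1 (tree, `nesterenkoWaldschmidt1996_thm_1_holds`)

decomp-schanuel lens 6, gen 24, node 3 (RULE G27 (iii): a registered Literature fact OUTSIDE NW96 that the tree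
consumes under binders, proved by the NW96 kernel with a parameter design).

TARGETS (registered statements, BY NAME):
* `waldschmidt1978_cor_3_7_holds : Literature.NumberTheory.Transcendental.Waldschmidt1978_cor_3_7`
  (`Literature/NumberTheory/Transcendental/LogAlgebraicTranscendenceMeasure.lean`): for `λ ≠ 0` with `e^λ`
  algebraic there is `C > 0` with `|P(λ)| ≥ exp(−C N² (log H + N log N)/(1 + log N))` for every non-zero
  `P ∈ ℤ[X]` of degree `≤ N` (`N ≥ 1`) and usual height `≤ H` (`H ≥ 16`);
* `w78LogMeasure_holds : Literature.Uncategorized.W78LogMeasure` — the vendored twin with the byte-identical body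
  (`w78LogMeasure_iff_cor_3_7 : … ↔ … := Iff.rfl`), the `hlm` binder of `RootDecomp1KHyper02/05/17/19`,
  `RootDecomp1KKummerClosure02–05/Cells`.

ROUTE.  (a) `log_approx_cijsouw`: NW96 Theorem 1 at `θ = λ`, `α = e^λ` (so `‖e^θ − α‖ = 0`), `β = ξ`, with the
DESIGN `E := e·D` (`D = [ℚ(e^λ, ξ) : ℚ]`; the paper's choice `E = eD` for `log 2`, Theorem 3, made uniform in
`λ`), `log A := log M(A_α) + 1`, `log B := log M(Q_ξ)/deg Q_ξ` (the exact Weil height, tree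
`MahlerWeil.weilHeight₁_root_eq`): `|λ − ξ| ≥ exp(−κ(λ)·d²(log L + d log d)/(1 + log d))`, `d = deg ξ`,
`L ≥ L(ξ)`, `L ≥ 3` — Cijsouw's shape; the factor `(1 + log D)⁻¹` is the saving `(3.3 D log(D+2) + log E)/log E
≤ 5D` against the second `log E = 1 + log D` (the tree's `RootDecomp1KKummerClosure.log_approx` takes `E = e` and a
polynomial exponent).  (b) Fel'dman's transference, tree
`NesterenkoWaldschmidt1996.transcendenceMeasure_of_approximationMeasure`, with the degree-monotone
`φ(d, L) = κ·d(log L + d log d)/(1 + log d)` (`wphi`; monotone because `d ↦ d/(1 + log d)` increases).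
(c) numerics: the `2^d`-loss and `L(P) ≤ (N+1)·H` are absorbed by `N log 2 + log(N+1) ≤ log H + N log N`
(`H ≥ 16`), giving `C = 2κ + 2`.  (d) `hNW` discharged by the tree's `nesterenkoWaldschmidt1996_thm_1_holds`
(RootDecomp1KNW96Core14).

Sorry-free; standard axioms; facts enter BY NAME only.  Nothing here proves Schanuel; rung 0.
-/

/-! ### §W1. Elementary real inequalities -/

/-- `d ↦ d/(1 + log d)` is increasing on `[1, ∞)`: `d (1 + log m) ≤ m (1 + log d)` for `1 ≤ d ≤ m`
(from `log(m/d) ≤ m/d − 1`). [folklore] -/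
private theorem mul_one_add_log_le {d m : ℝ} (hd : 1 ≤ d) (hdm : d ≤ m) :
    d * (1 + Real.log m) ≤ m * (1 + Real.log d) := by
  have hd0 : 0 < d := by linarith
  have hm0 : 0 < m := by linarith
  have h := Real.log_le_sub_one_of_pos (div_pos hm0 hd0)
  rw [Real.log_div hm0.ne' hd0.ne'] at h
  have h2 : d * (Real.log m - Real.log d) ≤ d * (m / d - 1) := mul_le_mul_of_nonneg_left h hd0.le
  have h3 : d * (m / d - 1) = m - d := by field_simp
  rw [h3] at h2
  have hld : 0 ≤ Real.log d := Real.log_nonneg hd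
  nlinarith [mul_le_mul_of_nonneg_right hdm hld]

/-- `d ≤ log L + d log d` for an integer `d ≥ 1` and `L ≥ 3` (so `d³ ≤ d² (log L + d log d)`).
[folklore] -/
private theorem self_le_log_add_mul_log {d : ℕ} (hd : 1 ≤ d) {L : ℝ} (hL : 3 ≤ L) :
    (d : ℝ) ≤ Real.log L + d * Real.log d := by
  have hlog3 : 1 < Real.log 3 := by
    rw [Real.lt_log_iff_exp_lt (by norm_num)]
    have := Real.exp_one_lt_d9; norm_num at this ⊢; linarith
  have hlogL : Real.log 3 ≤ Real.log L := Real.log_le_log (by norm_num) hL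
  have hl2 := Real.log_two_gt_d9
  rcases Nat.lt_or_ge d 3 with h | h
  · interval_cases d
    · norm_num; linarith
    · norm_num; linarith
  · have hd3 : (3 : ℝ) ≤ d := by exact_mod_cast h
    have hld : 1 ≤ Real.log d := hlog3.le.trans (Real.log_le_log (by norm_num) hd3)
    nlinarith

/-- The numerical absorptions for `N ≥ 1`, `H ≥ 16`:
`N log 2 + log(N+1) ≤ log H + N log N` and `log 2 + log N + log(N+1) ≤ log H + N log N`. [folklore] -/
private theorem log_absorb {N H : ℕ} (hN : 1 ≤ N) (hH : 16 ≤ H) :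
    (N : ℝ) * Real.log 2 + Real.log ((N : ℝ) + 1) ≤ Real.log H + N * Real.log N ∧
    Real.log 2 + Real.log N + Real.log ((N : ℝ) + 1) ≤ Real.log H + N * Real.log N := by
  have hl2 := Real.log_two_gt_d9
  have hl2' := Real.log_two_lt_d9
  have hH16 : (16 : ℝ) ≤ H := by exact_mod_cast hH
  have hlogH : 4 * Real.log 2 ≤ Real.log H := by
    have : Real.log 16 ≤ Real.log H := Real.log_le_log (by norm_num) hH16
    have h16 : Real.log 16 = 4 * Real.log 2 := by
      rw [show (16 : ℝ) = 2 ^ 4 by norm_num, Real.log_pow]; norm_num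
    linarith
  have hlog3 : Real.log 3 ≤ 4 * Real.log 2 := by
    rw [show 4 * Real.log 2 = Real.log 16 by
      rw [show (16 : ℝ) = 2 ^ 4 by norm_num, Real.log_pow]; norm_num]
    exact Real.log_le_log (by norm_num) (by norm_num)
  have hlog23 : Real.log 2 ≤ Real.log 3 := Real.log_le_log (by norm_num) (by norm_num)
  have hlog30 : 0 ≤ Real.log 3 := Real.log_nonneg (by norm_num)
  have hlog4 : Real.log 4 = 2 * Real.log 2 := by
    rw [show (4 : ℝ) = 2 ^ 2 by norm_num, Real.log_pow]; norm_num
  have hlog1 : Real.log 1 = 0 := Real.log_one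
  rcases Nat.lt_or_ge N 4 with h | h
  · interval_cases N
    · refine ⟨?_, ?_⟩ <;> norm_num <;> linarith
    · refine ⟨?_, ?_⟩ <;> norm_num <;> linarith
    · refine ⟨?_, ?_⟩ <;> norm_num [hlog4] <;> linarith
  · have hN4 : (4 : ℝ) ≤ N := by exact_mod_cast h
    have hN0 : (0 : ℝ) < N := by linarith
    have hlN : 2 * Real.log 2 ≤ Real.log N := hlog4 ▸ Real.log_le_log (by norm_num) hN4
    -- `log (N+1) ≤ N log 2` from `N + 1 ≤ 2^N`, and `log (N+1) ≤ log 2 + log N` from `N + 1 ≤ 2N`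
    have hpow : (N : ℝ) + 1 ≤ 2 ^ N := by exact_mod_cast Nat.lt_two_pow_self
    have hlN1 : Real.log ((N : ℝ) + 1) ≤ N * Real.log 2 := by
      have := Real.log_le_log (by linarith) hpow
      rwa [Real.log_pow] at this
    have hlN1' : Real.log ((N : ℝ) + 1) ≤ Real.log 2 + Real.log N := by
      rw [← Real.log_mul (by norm_num) hN0.ne']
      exact Real.log_le_log (by linarith) (by linarith)
    have hlogH0 : 0 ≤ Real.log H := by linarith
    constructor
    · nlinarith
    · nlinarith

/-! ### §W2. The degree-monotone approximation function with Cijsouw's shape -/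

/-- `φ_κ(d, L) = κ · d (log L + d log d)/(1 + log d)` — the approximation exponent per unit degree
(`d·φ = κ d²(log L + d log d)/(1 + log d)`). -/
noncomputable def wphi (κ : ℝ) (d L : ℕ) : ℝ :=
  κ * ((d : ℝ) * (Real.log L + d * Real.log d) / (1 + Real.log d))

/-- `φ_κ ≥ 0`. -/
theorem wphi_nonneg {κ : ℝ} (hκ : 0 ≤ κ) (d L : ℕ) : 0 ≤ wphi κ d L := by
  unfold wphi
  have h1 : 0 ≤ Real.log (L : ℝ) := Real.log_natCast_nonneg L
  have h2 : 0 ≤ Real.log (d : ℝ) := Real.log_natCast_nonneg d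
  positivity

/-- `φ_κ` is increasing in the degree. -/
theorem wphi_mono {κ : ℝ} (hκ : 0 ≤ κ) (n d L : ℕ) (h : n ≤ d) : wphi κ n L ≤ wphi κ d L := by
  rcases Nat.eq_zero_or_pos n with rfl | hn
  · have : wphi κ 0 L = 0 := by simp [wphi]
    rw [this]; exact wphi_nonneg hκ d L
  have hn1 : (1 : ℝ) ≤ n := by exact_mod_cast hn
  have hnd : (n : ℝ) ≤ d := by exact_mod_cast h
  have hd1 : (1 : ℝ) ≤ d := hn1.trans hnd
  have hlL : 0 ≤ Real.log (L : ℝ) := Real.log_natCast_nonneg L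
  have hln : 0 ≤ Real.log (n : ℝ) := Real.log_nonneg hn1
  have hld : 0 ≤ Real.log (d : ℝ) := Real.log_nonneg hd1
  have hlnd : Real.log (n : ℝ) ≤ Real.log d := Real.log_le_log (by linarith) hnd
  unfold wphi
  refine mul_le_mul_of_nonneg_left ?_ hκ
  rw [show (n : ℝ) * (Real.log L + n * Real.log n) / (1 + Real.log n) =
      (n : ℝ) / (1 + Real.log n) * (Real.log L + n * Real.log n) by ring,
    show (d : ℝ) * (Real.log L + d * Real.log d) / (1 + Real.log d) =
      (d : ℝ) / (1 + Real.log d) * (Real.log L + d * Real.log d) by ring]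
  refine mul_le_mul ?_ ?_ (by positivity) (by positivity)
  · rw [div_le_div_iff₀ (by positivity) (by positivity)]
    exact mul_one_add_log_le hn1 hnd
  · nlinarith [mul_le_mul hnd hlnd hln (by linarith : (0 : ℝ) ≤ d)]

/-- `d · φ_κ(d, L) ≥ κ` for `d ≥ 1`, `L ≥ 3` (used for the trivial approximant `ξ = 0`). -/
theorem kappa_le_mul_wphi {κ : ℝ} (hκ : 0 ≤ κ) {d : ℕ} (hd : 1 ≤ d) {L : ℕ} (hL : 3 ≤ L) :
    κ ≤ (d : ℝ) * wphi κ d L := by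
  have hd1 : (1 : ℝ) ≤ d := by exact_mod_cast hd
  have hL3 : (3 : ℝ) ≤ L := by exact_mod_cast hL
  have hlog3 : 1 ≤ Real.log (L : ℝ) := by
    have h3 : 1 < Real.log 3 := by
      rw [Real.lt_log_iff_exp_lt (by norm_num)]
      have := Real.exp_one_lt_d9; norm_num at this ⊢; linarith
    exact h3.le.trans (Real.log_le_log (by norm_num) hL3)
  have hld : 0 ≤ Real.log (d : ℝ) := Real.log_nonneg hd1
  have hld' : Real.log (d : ℝ) ≤ d - 1 := by
    have := Real.log_le_sub_one_of_pos (by linarith : (0 : ℝ) < d); linarith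
  -- `d (log L + d log d)/(1 + log d) ≥ log L ≥ 1` since `1 + log d ≤ d`
  have hcore : 1 ≤ (d : ℝ) * (Real.log L + d * Real.log d) / (1 + Real.log d) := by
    rw [le_div_iff₀ (by positivity)]
    nlinarith [mul_nonneg (by linarith : (0 : ℝ) ≤ d) hld]
  have hw : κ ≤ wphi κ d L := by
    unfold wphi
    nlinarith
  have hw0 : 0 ≤ wphi κ d L := wphi_nonneg hκ d L
  nlinarith

/-! ### §W3. The approximation measure for `λ` with `e^λ ∈ ℚ̄` in Cijsouw's shape (mod NW96 Thm 1) -/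

/-- The constant `κ(λ)`: `n_α = deg α`, `a = log M(A_α) + 1`, `T = |λ|`. -/
noncomputable def kappaLog (nα : ℕ) (a T : ℝ) : ℝ :=
  1055 * (a + 6 * T + 6) * (nα : ℝ) ^ 3 * (19 + 6 * Real.log nα + Real.log a + 2 * Real.log (max 1 T)) +
    |Real.log T|

/-- `0 ≤ kappaLog nα a T` under the standing sign conditions. -/
theorem kappaLog_nonneg {nα : ℕ} (hn : 1 ≤ nα) {a T : ℝ} (ha : 1 ≤ a) (hT : 0 ≤ T) :
    0 ≤ kappaLog nα a T := by
  unfold kappaLog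
  have h1 : 0 ≤ Real.log (nα : ℝ) := Real.log_nonneg (by exact_mod_cast hn)
  have h2 : 0 ≤ Real.log a := Real.log_nonneg ha
  have h3 : 0 ≤ Real.log (max 1 T) := Real.log_nonneg (le_max_left _ _)
  have h4 : 0 ≤ |Real.log T| := abs_nonneg _
  have h5 : (0 : ℝ) ≤ a := by linarith
  positivity

/-- **The real-variable heart of the instance analysis.**  The NW96 exponent at `log A = a`,
`log B = b ≤ (log L)/d`, `E = e·D` (so `log E = 1 + log D`, `log(E|λ|₊) = 1 + log D + log |λ|₊`), with
`d ≤ D ≤ n d`, is at most `κ · d²(log L + d log d)/(1 + log d)` as soon as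
`κ ≥ 1055 (a + 6T + 6) n³ (19 + 6 log n + log a + 2 log |λ|₊)`.  Ingredients:
`F₂ = D a + 2eDT + 6(1 + log D) ≤ D(a + 6T + 6)` (`2e < 6`, `1 + log D ≤ D`);
`F₃ = 3.3 D log(D+2) + (1 + log D) ≤ 5D(1 + log D)` (`log(D+2) ≤ log 3 + log D ≤ 1.1(1 + log D)`) — this
is THE SAVING: one factor `1 + log D = log E` cancels against `(log E)²` and the other survives as the
denominator; `D³ F₁ ≤ n³(7 + 6 log n + log a + 2 log|λ|₊ + 12)·d²(log L + d log d)` using `D ≤ nd`,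
`log D ≤ log n + log d`, `b ≤ (log L)/d` and `d³ ≤ d²(log L + d log d)`; finally `1 + log d ≤ 1 + log D`. -/
theorem cijsouw_real {a T b D d n lL κ : ℝ} (ha : 1 ≤ a) (hT : 0 ≤ T) (hd : 1 ≤ d) (hdD : d ≤ D)
    (hDle : D ≤ n * d) (hn : 1 ≤ n) (hb0 : 0 ≤ b) (hbL : b ≤ lL / d) (hlL : 1 ≤ lL)
    (hdG : d ≤ lL + d * Real.log d)
    (hκ : 1055 * (a + 6 * T + 6) * n ^ 3 * (19 + 6 * Real.log n + Real.log a + 2 * Real.log (max 1 T)) ≤ κ) :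
    211 * D * (b + Real.log a + 4 * Real.log D + 2 * (1 + Real.log D + Real.log (max 1 T)) + 10) *
        (D * a + 2 * (Real.exp 1 * D) * T + 6 * (1 + Real.log D)) *
        (33 / 10 * D * Real.log (D + 2) + (1 + Real.log D)) / (1 + Real.log D) ^ 2 ≤
      κ * (d ^ 2 * (lL + d * Real.log d) / (1 + Real.log d)) := by
  obtain ⟨lD, hlD⟩ : ∃ x : ℝ, x = Real.log D := ⟨_, rfl⟩
  obtain ⟨ld, hld⟩ : ∃ x : ℝ, x = Real.log d := ⟨_, rfl⟩
  obtain ⟨lm, hlm⟩ : ∃ x : ℝ, x = Real.log (max 1 T) := ⟨_, rfl⟩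
  obtain ⟨G, hG⟩ : ∃ x : ℝ, x = lL + d * Real.log d := ⟨_, rfl⟩
  rw [← hlD, ← hlm, ← hG, ← hld]
  rw [← hld] at hdG hG
  have hd0 : 0 < d := by linarith
  have hD1 : 1 ≤ D := hd.trans hdD
  have hD0 : 0 < D := by linarith
  have ha0 : 0 ≤ a := by linarith
  have hn0 : 0 ≤ n := by linarith
  have hla : 0 ≤ Real.log a := Real.log_nonneg ha
  have hln : 0 ≤ Real.log n := Real.log_nonneg hn
  have hlm0 : 0 ≤ lm := by rw [hlm]; exact Real.log_nonneg (le_max_left _ _)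
  have hlD0 : 0 ≤ lD := by rw [hlD]; exact Real.log_nonneg hD1
  have hld0 : 0 ≤ ld := by rw [hld]; exact Real.log_nonneg hd
  have hlDd : ld ≤ lD := by rw [hld, hlD]; exact Real.log_le_log hd0 hdD
  have hlDle : lD ≤ Real.log n + ld := by
    rw [hlD, hld, ← Real.log_mul (by linarith) hd0.ne']
    exact Real.log_le_log hD0 hDle
  have hlDD : 1 + lD ≤ D := by
    have := Real.log_le_sub_one_of_pos hD0; rw [← hlD] at this; linarith
  have hP0 : 0 < 1 + lD := by linarith
  have hP0' : 1 + lD ≠ 0 := hP0.ne'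
  have hPd : 0 < 1 + ld := by linarith
  have hG0 : 0 ≤ G := by rw [hG]; positivity
  have hlogLG : lL ≤ G := by rw [hG]; nlinarith
  have hdldG : d * ld ≤ G := by rw [hG]; linarith
  have hdG' : d ≤ G := by rw [hG]; exact hdG
  -- the three factors
  have hF1pos : 0 ≤ b + Real.log a + 4 * lD + 2 * (1 + lD + lm) + 10 := by positivity
  have hF2 : D * a + 2 * (Real.exp 1 * D) * T + 6 * (1 + lD) ≤ D * (a + 6 * T + 6) := by
    have h2e : 2 * Real.exp 1 ≤ 6 := by
      have := Real.exp_one_lt_d9; norm_num at this; linarith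
    nlinarith [mul_le_mul_of_nonneg_right h2e (mul_nonneg hD0.le hT)]
  have hF3 : 33 / 10 * D * Real.log (D + 2) + (1 + lD) ≤ 5 * D * (1 + lD) := by
    have hlog3 : Real.log 3 ≤ 11 / 10 := (log_consts).2.1
    have hD2 : Real.log (D + 2) ≤ 11 / 10 * (1 + lD) := by
      have : Real.log (D + 2) ≤ Real.log (3 * D) := Real.log_le_log (by linarith) (by linarith)
      rw [Real.log_mul (by norm_num) hD0.ne', ← hlD] at this
      nlinarith
    nlinarith [mul_le_mul_of_nonneg_left hD2 (by linarith : (0 : ℝ) ≤ 33 / 10 * D)]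
  have hF3pos : 0 ≤ 33 / 10 * D * Real.log (D + 2) + (1 + lD) := by
    have : 0 ≤ Real.log (D + 2) := Real.log_nonneg (by linarith)
    positivity
  -- step 1: bound `F₂`, `F₃` and cancel one `1 + log D`
  have hstep1 : 211 * D * (b + Real.log a + 4 * lD + 2 * (1 + lD + lm) + 10) *
        (D * a + 2 * (Real.exp 1 * D) * T + 6 * (1 + lD)) *
        (33 / 10 * D * Real.log (D + 2) + (1 + lD)) / (1 + lD) ^ 2 ≤
      1055 * (a + 6 * T + 6) * (D ^ 3 * (b + 6 * lD + (Real.log a + 2 * lm + 12))) / (1 + lD) := by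
    have hnum : 211 * D * (b + Real.log a + 4 * lD + 2 * (1 + lD + lm) + 10) *
        (D * a + 2 * (Real.exp 1 * D) * T + 6 * (1 + lD)) *
        (33 / 10 * D * Real.log (D + 2) + (1 + lD)) ≤
        211 * D * (b + Real.log a + 4 * lD + 2 * (1 + lD + lm) + 10) *
        (D * (a + 6 * T + 6)) * (5 * D * (1 + lD)) := by
      gcongr
    refine (div_le_div_of_nonneg_right hnum (by positivity)).trans (le_of_eq ?_)
    field_simp
    ring
  -- step 2: `D³ F₁ ≤ n³ (7 + 6 log n + w) · d² G`
  have hstep2 : D ^ 3 * (b + 6 * lD + (Real.log a + 2 * lm + 12)) ≤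
      n ^ 3 * (7 + 6 * Real.log n + (Real.log a + 2 * lm + 12)) * (d ^ 2 * G) := by
    have hF1' : b + 6 * lD + (Real.log a + 2 * lm + 12) ≤
        lL / d + 6 * Real.log n + 6 * ld + (Real.log a + 2 * lm + 12) := by linarith
    have hF1'0 : 0 ≤ b + 6 * lD + (Real.log a + 2 * lm + 12) := by positivity
    have hD3 : D ^ 3 ≤ (n * d) ^ 3 := by gcongr
    calc D ^ 3 * (b + 6 * lD + (Real.log a + 2 * lm + 12))
        ≤ (n * d) ^ 3 * (lL / d + 6 * Real.log n + 6 * ld + (Real.log a + 2 * lm + 12)) :=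
          mul_le_mul hD3 hF1' hF1'0 (by positivity)
      _ = n ^ 3 * (d ^ 2 * lL + 6 * (d ^ 2 * (d * ld)) +
            (6 * Real.log n + (Real.log a + 2 * lm + 12)) * (d ^ 2 * d)) := by
          field_simp
          ring
      _ ≤ n ^ 3 * (d ^ 2 * G + 6 * (d ^ 2 * G) +
            (6 * Real.log n + (Real.log a + 2 * lm + 12)) * (d ^ 2 * G)) := by
          gcongr
      _ = n ^ 3 * (7 + 6 * Real.log n + (Real.log a + 2 * lm + 12)) * (d ^ 2 * G) := by ring
  -- step 3: assemble
  have hK : 1055 * (a + 6 * T + 6) * (n ^ 3 * (7 + 6 * Real.log n + (Real.log a + 2 * lm + 12))) ≤ κ := by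
    have : 1055 * (a + 6 * T + 6) * (n ^ 3 * (7 + 6 * Real.log n + (Real.log a + 2 * lm + 12))) =
        1055 * (a + 6 * T + 6) * n ^ 3 * (19 + 6 * Real.log n + Real.log a + 2 * lm) := by ring
    rw [this, hlm]; exact hκ
  have hd2G : 0 ≤ d ^ 2 * G := by positivity
  calc 211 * D * (b + Real.log a + 4 * lD + 2 * (1 + lD + lm) + 10) *
        (D * a + 2 * (Real.exp 1 * D) * T + 6 * (1 + lD)) *
        (33 / 10 * D * Real.log (D + 2) + (1 + lD)) / (1 + lD) ^ 2
      ≤ 1055 * (a + 6 * T + 6) * (D ^ 3 * (b + 6 * lD + (Real.log a + 2 * lm + 12))) / (1 + lD) :=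
        hstep1
    _ ≤ 1055 * (a + 6 * T + 6) *
        (n ^ 3 * (7 + 6 * Real.log n + (Real.log a + 2 * lm + 12)) * (d ^ 2 * G)) / (1 + lD) := by
        gcongr
    _ = 1055 * (a + 6 * T + 6) *
        (n ^ 3 * (7 + 6 * Real.log n + (Real.log a + 2 * lm + 12))) * (d ^ 2 * G) / (1 + lD) := by
        ring
    _ ≤ 1055 * (a + 6 * T + 6) *
        (n ^ 3 * (7 + 6 * Real.log n + (Real.log a + 2 * lm + 12))) * (d ^ 2 * G) / (1 + ld) :=
        div_le_div_of_nonneg_left (by positivity) hPd (by linarith)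
    _ ≤ κ * (d ^ 2 * G) / (1 + ld) := by gcongr
    _ = κ * (d ^ 2 * G / (1 + ld)) := by ring

end W78Log

end Summit.Schanuel.Schanuel.Theorems.RootDecomp1KNW96Core
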